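import Summits.QuantumFields.YangMills.Theorems.FluctuationComparisonRegPrIntLS2BetaHFlatOfFeeders
import Summits.QuantumFields.YangMills.Theorems.FluctuationComparisonRegPrIntLS2BetaRelativeTowerSupBudget
import Summits.QuantumFields.YangMills.Theorems.FluctuationComparisonRegPrIntLS2BetaWhitneyHatLiftCurvatureSq
import Summits.QuantumFields.YangMills.Theorems.FluctuationComparisonRegPrIntLS2BetaRelativeFieldSquareSumPlaq
import Summits.QuantumFields.YangMills.Theorems.FluctuationComparisonRegPrIntLS2BetaCorrLetterL2
import HarnessLib

/-!
# S2β · `hFlat` road (UV3-NODE §57.8 (B)) — THE GRAND ASSEMBLY: THE REGISTERED `hFlat` LETTER FROM THE KEY LEMMA ALONE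
# `hFlat_of_keyLemma (hKEY) : ⟨hFlat — ✓(D10)'s third hypothesis, VERBATIM⟩`

Cell `ym3-torus` (YM ladder rung R3 = continuum `SU(2)` Yang–Mills on the three-torus — a RUNG: NOT d = 4, NOT infinite volume, NOT a mass gap,
NOT Clay).  Width seat «width 17» `ym3-torus-px17` (gen 19), FREE px helper on crux `stmt-QuantumFields-20520`
(`Theses.UnitScaleTilt.FluctuationComparisonRegPrIntL`); `--kind proof --supports stmt-QuantumFields-20520 --as helper`, count-neutral, DEFINITION-FREE
(0 `def`, 0 `instance`, 0 `notation`, 0 `sorry`); ONE declaration carries `set_option maxHeartbeats 400000 in` (the cell's CI-cliff rule: the composition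
is term-heavy, ≈ 10 s on the farm; it passes at 160 000, no `simp`∕`decide` search).

WHAT.  The depth-uniform flat letter `hFlat` of the registered stiffness organ GAP♯∘ (`Lines/semiclassical_s2beta.lean` v11.4 :768∕:1387; third hypothesis of
✓p811100 `…S2BetaGapOrbitOfStrata.uniformFibreGapOrbit_of_strata_of_flat`) FOLLOWS, by kernel, from ONE displayed hypothesis — the nonabelian KEY LEMMA of
§57.8 (C) in its torus currency:
    `hKEY : ∀ L > 1, ∀ b₀ p₀ > 0, ∃ γ₁ > 0, ∀ γ (0 < γ ≤ γ₁) F (F.L = L) (J ≤ K) (U ∈ histGood(θBal b₀ p₀) K J),`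
    `        ∀ t ≤ K−J, ‖dist1 (M^tU)(∂·)‖_{ℓ²(Plaq_t)} ≤ e·(√L)^t·‖dist1 U(∂·)‖_{ℓ²(Plaq_0)}`
— CHARACTER-FOR-CHARACTER the statement of px13 g23's ★★★★`keyLemma_record` (`Theorems/FluctuationComparisonRegPrIntLS2BetaKeyLemmaRecordE2E.lean`, HOME
`ym3-torus-px13/g23/….PREPARED.px13g23.lean` ef755e1ad60044a4; = px8 G11 `keyLemma_tower_sqrtL` ∘ px12 g23 ✓p816714 `tentKernel_schur` ∘ px10 g22 ✓p817736
`oneLevelStep`; in flight at filing time) universally closed over `(L, hL, b₀, p₀, hb, hp)`, so that ONCE IT LANDS `hFlat_of_keyLemma keyLemma_record : hFlat` is ONE TERM.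
EVERYTHING ELSE IS IN THE TREE AND COMPOSED HERE BY NAME: ENTRY ✓p815840 `hFlat_of_inIterTube` (its tube letter idle: radius `1`, the KEY LEMMA needs none) ∘ door ✓p816498 `dockB_inner` (stage tower
✓p816142 inside; the hat lift and its weights as px12's formulas, here OPAQUE local functions with their defining equations; (R1) = ✓p815895
`sum_sq_arc_lift_le_three`) ∘ ✓p817191 `relLetter_of_feeders` with F2 := px13 g22 ✓p816657 `sq_sum_le_plaq` ((T4) = its `hax`), F1 := `hKEY`, F3 := px12 g23
✓`…WhitneyHatLiftCurvatureSq.sum_plaq_dist1_lift_sq_le` after one `√(a+b) ≤ √a+√b` (`C_F = √c·π`, `C_S = √c·√(6912·2)`, `c = L⁻⁴·L³`), F4 := px21 g21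
✓`…S2BetaCorrLetterL2.sqrt_sum_dist1_spine_sq_le` (the `havg` from (T5) + ✓`axialAvg_lift`; its guards `((d+2)L)²∕4·a₀ ≤ 1∕4`, `< δ_SU2` by the choice of
`a₀` and ✓`thresholdSum_small`), S := ✓p817429 `exists_gamma_supBudget` (`Sbud = 1∕8`, every level `≤ 1∕8`); `γ₁ := min(γK, γS, γ₄)`,
`E := (π∕2)·√(2Cs)·C_S·(1∕8)∕√L`, `C := (π∕2)·e·(√(2Cs)·(1 + C_F·√L) + √CL·C₄) + 1`, **`μ := ((L−1)∕(exp E·C))²∕4`** — depth- and volume-free.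

SO THE GAP LIST OF `hFlat` (★p1's purpose «every gap named») IS NOW ONE LINE: the KEY LEMMA `hKEY`.  With it, `hFlat` is a theorem; with ✓(D10) and the
strata letters `hIrr`∕`hA` (UV3-NODE §54, untouched) the REGISTERED `stub_uniformFibreGapOrbit` would follow — none of which is claimed here.

HONEST SCOPE.  Quantifier∕ℓ² plumbing by name over landed theorems; `hKEY` is an undischarged HYPOTHESIS carrying all of the road's remaining analysis
([Balaban1984PropagatorsI] Prop. 1.1 (1.89)–(1.90) p.33 ∕ [Balaban1984PropagatorsII] Prop. 2.2 (2.67) p.234 are the printed loci of the quadratic floor this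
road replaces by px8 g21's elementary telescoping; [Balaban1985RegularSpaces] (1.29) p.81, (1.65) p.87); `hFlat` (unconditionally), TUBE-REG∘ (`hIrr`, `hA`), GAP♯∘
(`stub_uniformFibreGapOrbit`), EXW∘, DET-REP-B, H4ᶜ∘, LFR♯ᶜ∘, S2β, the five registered stubs (0∕5 moved), crux 20520, 19936, 19200, `B8Thm2AtT3Members` at
`L = 3` and `YM3TorusSU2` are NOT proved; no registered stub is closed by a helper; rung R3 = SU(2) YM₃ on T³ at fixed lattice data — NOT d = 4, NOT infinite
volume, NOT a mass gap, NOT Clay; the Yang–Mills mass gap is NOT proved.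
References: T. Bałaban, CMP **95** (1984) 17–40 [Balaban1984PropagatorsI]; CMP **96** (1984) 223–250 [Balaban1984PropagatorsII]; CMP **99** (1985) 75–102
[Balaban1985RegularSpaces]; CMP **102** (1985) 255–275 [Balaban1985UV3] ((7) p.257).
-/

set_option autoImplicit false

noncomputable section

namespace Summit.QuantumFields.YangMills.Theorems.FluctuationComparisonRegPrIntLS2BetaHFlatOfKeyLemma

open Finset
open scoped Real
open Literature.MathematicalPhysics.QuantumLattice (su2Quat)
open Literature.MathematicalPhysics.QuantumFieldTheory.Balaban1983to89
open T4Continuum T3ContinuumYM3Torus T3UnitScaleTilt T3TiltDescent T3LevelShift BlockAveraging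
open T4CubeChartGnomonic (SU2)
open T4HaarSU2ExpChart (expPoint)
open T4ExpWindowSmallField (logVec)
open T3UnitLawDensityEML (ℰp)
open T3ConstrainedMinimiser (fibre)
open T3PrintedRegularMinimiser (minActionRegPr)
open B10Eq27TorusAxialLog (rel axialT)
open Summit.QuantumFields.YangMills.Theorems.FluctuationComparisonRegPrIntLS2BetaHFlatOfRelativeLetter (dockB_inner)
open Summit.QuantumFields.YangMills.Theorems.FluctuationComparisonRegPrIntLS2BetaHFlatOfFeeders (relLetter_of_feeders sqrt_add_le_sqrt_add_sqrt_real)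
open Summit.QuantumFields.YangMills.Theorems.FluctuationComparisonRegPrIntLS2BetaRelativeTowerSupBudget (exists_gamma_supBudget)
open Summit.QuantumFields.YangMills.Theorems.FluctuationComparisonRegPrIntLS2BetaWhitneyHatLift (axialAvg_lift sum_sq_arc_lift_le_three)
open Summit.QuantumFields.YangMills.Theorems.FluctuationComparisonRegPrIntLS2BetaWhitneyHatLiftCurvatureSq (sum_plaq_dist1_lift_sq_le)
open Summit.QuantumFields.YangMills.Theorems.FluctuationComparisonRegPrIntLS2BetaRelativeFieldSquareSumPlaq (sq_sum_le_plaq)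
open Summit.QuantumFields.YangMills.Theorems.FluctuationComparisonRegPrIntLS2BetaRelativeFieldLetter (dist1_axialAvg_mul_inv_eq_corr)
open Summit.QuantumFields.YangMills.Theorems.FluctuationComparisonRegPrIntLS2BetaThresholdSum (thresholdSum_small)
open Summit.QuantumFields.YangMills.Theorems.FluctuationComparisonRegPrIntLS2BetaCorrLetterL2 (sqrt_sum_dist1_spine_sq_le)

set_option maxHeartbeats 400000 in
/-- ★★★★ **THE GRAND ASSEMBLY**: the registered `hFlat` letter (third hypothesis of ✓p811100 `uniformFibreGapOrbit_of_strata_of_flat`, VERBATIM) from the KEY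
LEMMA (F1) ALONE — everything else (incl. F4 = px21 g21 ✓`…S2BetaCorrLetterL2.sqrt_sum_dist1_spine_sq_le`) (ENTRY ✓p815840, stage tower ✓p816142, door ✓p816498, bond split∕(ii-b) ℓ² ✓p816657, hat
lift (R1) ✓p815895, flap-ℓ² ✓px12 `sum_plaq_dist1_lift_sq_le`, sup profile ✓p816895 ∘ bootstrap ✓p816768 ∘ budget ✓`exists_gamma_supBudget`, feeders ✓p817191,
threshold sum ✓`thresholdSum_small`) is in the tree and composed here by name.  (Heartbeat budget: the composition elaborates in ≈ 10 s; the
declaration carries an explicit `maxHeartbeats 400000` per the cell's CI-cliff rule — no `simp`∕`decide` search, only term size.) [cite: Balaban1984PropagatorsI, Prop. 1.1 (1.89)-(1.90) p.33; Balaban1985RegularSpaces, (1.29) p.81, (1.65) p.87] -/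
theorem hFlat_of_keyLemma
    (hKEY : ∀ (L : ℕ), 1 < L → ∀ (b₀ p₀ : ℝ), 0 < b₀ → 0 < p₀ → ∃ γ₁ : ℝ, 0 < γ₁ ∧ ∀ γ : ℝ, 0 < γ → γ ≤ γ₁ →
      ∀ (F : T3Family), F.L = L → ∀ (J K : ℕ), J ≤ K → ∀ U : GaugeField (F.P K) 0 SU2,
        U ∈ histGood F ℰp (θBal F.L γ b₀ p₀) K J → ∀ t, t ≤ K - J →
          √(∑ p, dist1 (GaugeField.plaqHol (Averaging.iter (fun k => blockAvg (P := F.P K) (j := k) ℰp) t U) p) ^ 2) ≤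
            Real.exp 1 * Real.sqrt (F.L : ℝ) ^ t * √(∑ p, dist1 (GaugeField.plaqHol U p) ^ 2)) :
    ∀ (L : ℕ), ∃ pS : ℝ, ∀ (b₀ p₀ : ℝ), 0 < b₀ → pS ≤ p₀ → 0 < p₀ → ∃ ε₁ : ℝ, 0 < ε₁ ∧ ∀ (ε₀ : ℝ), 0 < ε₀ → ε₀ ≤ ε₁ →
    ∃ γ₁ : ℝ, 0 < γ₁ ∧ ∃ μ : ℝ, 0 < μ ∧ ∀ (F : T3Family) (γ : ℝ), F.L = L → 0 < γ → γ ≤ γ₁ →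
      ∀ (J K : ℕ) (hlt : J < K),
        ∀ U ∈ fibre F ℰp J K hlt.le (1 : GaugeField (F.P J) 0 SU2), U ∈ histGood F ℰp (θBal F.L γ b₀ p₀) K J →
          μ * ((F.L : ℝ)⁻¹) ^ (2 * (K - J)) *
              (⨅ w : {w : Site (F.P K) 0 → SU2 |
                  ∀ U : GaugeField (F.P K) 0 SU2,
                    descendTo F ℰp J K hlt.le (GaugeField.gaugeAct w U) = descendTo F ℰp J K hlt.le U},
                ∑ ℓ : PBond (F.P K) 0,
                  dist1 (U ℓ * ((GaugeField.gaugeAct (w : Site (F.P K) 0 → SU2) (1 : GaugeField (F.P K) 0 SU2)) ℓ)⁻¹) ^ 2)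
            ≤ wilsonAction4 U - minActionRegPr F J K hlt.le ε₀ (1 : GaugeField (F.P J) 0 SU2) := by
  refine FluctuationComparisonRegPrIntLS2BetaIterFlatTubeWLOG.hFlat_of_inIterTube fun L => ?_
  by_cases hL : 1 < L
  swap
  · refine ⟨1, one_pos, 0, fun b₀ p₀ _ _ _ => ⟨1, one_pos, fun ε₀ _ _ => ⟨1, one_pos, 1, one_pos, fun F γ hFL => ?_⟩⟩⟩
    exact absurd (hFL ▸ F.hL.2) hL
  have hL' : (1 : ℝ) < L := by exact_mod_cast hL
  have hL0 : (0 : ℝ) < L := by linarith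
  -- px21's corr-letter constants at `d = 3`: the loop guard `G·a₀ ≤ 1∕4 ∧ < δ_SU` and `C₄`
  obtain ⟨G, hG⟩ : ∃ x : ℝ, x = ((((3 + 2) * L : ℕ) : ℝ) ^ 2 / 4) := ⟨_, rfl⟩
  have hG0 : 0 < G := by rw [hG]; positivity
  have hδSU := ExpMeanLog.deltaSU_pos (n := Fin 2)
  obtain ⟨a₀, ha₀⟩ : ∃ x : ℝ, x = min (1 / (4 * G)) (ExpMeanLog.deltaSU (Fin 2) / (2 * G)) := ⟨_, rfl⟩
  have ha₀0 : 0 < a₀ := by rw [ha₀]; exact lt_min (by positivity) (by positivity)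
  have hGa4 : G * a₀ ≤ 1 / 4 := by
    have h1 : a₀ ≤ 1 / (4 * G) := by rw [ha₀]; exact min_le_left _ _
    calc G * a₀ ≤ G * (1 / (4 * G)) := mul_le_mul_of_nonneg_left h1 hG0.le
      _ = 1 / 4 := by field_simp
  have hGaN : G * a₀ < ExpMeanLog.deltaSU (Fin 2) := by
    have h1 : a₀ ≤ ExpMeanLog.deltaSU (Fin 2) / (2 * G) := by rw [ha₀]; exact min_le_right _ _
    calc G * a₀ ≤ G * (ExpMeanLog.deltaSU (Fin 2) / (2 * G)) := mul_le_mul_of_nonneg_left h1 hG0.le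
      _ = ExpMeanLog.deltaSU (Fin 2) / 2 := by field_simp
      _ < ExpMeanLog.deltaSU (Fin 2) := by linarith
  obtain ⟨C₄, hC4⟩ : ∃ x : ℝ, x = 3 * G * √(((3 ^ 3 * L ^ 3 * 3 ^ 2 : ℕ) : ℝ) * ((3 ^ 3 * 3 : ℕ) : ℝ)) := ⟨_, rfl⟩
  have hC₄ : 0 ≤ C₄ := by rw [hC4]; positivity
  -- the constants of the feeders at `d = 3`, block size `L` (functions of `L` only)
  obtain ⟨Cs, hCs⟩ : ∃ x : ℝ, x = (2 * ((3 - 1) * ((L - 1) / 2) : ℕ) * (2 * L ^ 3 * ((3 - 1) * ((L - 1) / 2)) : ℕ) +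
      4 * ((3 - 1) * ((L - 1) / 2) * (L + 1) : ℕ) * (2 * L ^ 3 * ((3 - 1) * ((L - 1) / 2) * (L + 1)) : ℕ) : ℝ) := ⟨_, rfl⟩
  obtain ⟨CL, hCL⟩ : ∃ x : ℝ, x = 2 * (L : ℝ) ^ (3 - 1) := ⟨_, rfl⟩
  obtain ⟨cF, hcF⟩ : ∃ x : ℝ, x = (((L : ℝ)⁻¹) ^ 2) ^ 2 * (L : ℝ) ^ 3 := ⟨_, rfl⟩
  have hCs0 : 0 ≤ Cs := by rw [hCs]; positivity
  have hCL0 : 0 ≤ CL := by rw [hCL]; positivity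
  have hcF0 : 0 ≤ cF := by rw [hcF]; positivity
  obtain ⟨C_F, hC_F⟩ : ∃ x : ℝ, x = √cF * π := ⟨_, rfl⟩
  obtain ⟨C_S, hC_S⟩ : ∃ x : ℝ, x = √cF * √(6912 * ((3 : ℝ) - 1)) := ⟨_, rfl⟩
  have hC_F0 : 0 ≤ C_F := by rw [hC_F]; positivity
  have hC_S0 : 0 ≤ C_S := by rw [hC_S]; positivity
  -- the tube radius of the ENTRY is idle here (the KEY LEMMA needs no tube): take `1`
  refine ⟨1, one_pos, 0, fun b₀ p₀ hb _ hp => ⟨1, one_pos, fun ε₀ hε₀ _ => ?_⟩⟩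
  obtain ⟨γK, hγK, hkey⟩ := hKEY L hL b₀ p₀ hb hp
  obtain ⟨Kc, hKc'⟩ : ∃ x : ℝ, x = Real.exp 1 := ⟨_, rfl⟩
  have hKc : 0 ≤ Kc := by rw [hKc']; exact (Real.exp_pos 1).le
  obtain ⟨γS, hγS, hsup⟩ := exists_gamma_supBudget L hL b₀ p₀ hb hp
  obtain ⟨γ₄, hγ₄, hth⟩ := thresholdSum_small L hL b₀ p₀ hb hp 0 a₀ 1 le_rfl ha₀0 one_pos
  -- the budget and the constant of (H)
  obtain ⟨E, hE⟩ : ∃ x : ℝ, x = π / 2 * √(2 * Cs) * C_S * (1 / 8) / Real.sqrt (L : ℝ) := ⟨_, rfl⟩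
  obtain ⟨C, hC⟩ : ∃ x : ℝ, x = π / 2 * (Kc * (√(2 * Cs) * (1 + C_F * Real.sqrt (L : ℝ)) + √CL * C₄)) + 1 := ⟨_, rfl⟩
  have hC0 : 0 < C := by rw [hC]; positivity
  refine ⟨min γK (min γS γ₄), lt_min hγK (lt_min hγS hγ₄), ((L - 1 : ℝ) / (Real.exp E * C)) ^ 2 / 4, ?_,
    fun F γ hFL hγ hγ1 J K hlt U hUf hUg _ => ?_⟩
  · have : 0 < (L - 1 : ℝ) / (Real.exp E * C) := div_pos (by linarith) (mul_pos (Real.exp_pos E) hC0)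
    positivity
  have hγK' : γ ≤ γK := hγ1.trans (min_le_left _ _)
  have hγS' : γ ≤ γS := hγ1.trans ((min_le_right _ _).trans (min_le_left _ _))
  have hγ4' : γ ≤ γ₄ := hγ1.trans ((min_le_right _ _).trans (min_le_right _ _))
  have hFL' : (F.L : ℝ) = L := by exact_mod_cast hFL
  have hLF : 1 < (F.L : ℝ) := by rw [hFL']; exact hL'
  have hPd : (F.P K).d = 3 := rfl
  have hPL : (F.P K).L = L := hFL
  have hθa : ∀ i, θBal F.L γ b₀ p₀ i ≤ a₀ := fun i => by rw [hFL]; exact ((hth γ hγ hγ4').1 i).2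
  -- the hat weights and the hat lift (px12's formulas), the lift as an OPAQUE function with its defining equation
  obtain ⟨w, hw⟩ : ∃ f : (j : ℕ) → PBond (F.P K) j → PBond (F.P K) (j + 1) → ℝ, f = fun j b e =>
      if e.dir = b.dir ∧ (b.src b.dir - emb e.src b.dir).val < (F.P K).L then
        ∏ ν ∈ Finset.univ.erase b.dir, max 0 (1 - ((rel (emb e.src) b.src ν).natAbs : ℝ) / (F.P K).L) else 0 := ⟨_, rfl⟩
  have hw' : ∀ j b e, w j b e = if e.dir = b.dir ∧ (b.src b.dir - emb e.src b.dir).val < (F.P K).L then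
      ∏ ν ∈ Finset.univ.erase b.dir, max 0 (1 - ((rel (emb e.src) b.src ν).natAbs : ℝ) / (F.P K).L) else 0 :=
    fun j b e => by rw [hw]
  obtain ⟨lift, hlift⟩ : ∃ f : (j : ℕ) → GaugeField (F.P K) (j + 1) SU2 → GaugeField (F.P K) j SU2,
      f = fun j X b => expPoint (∑ e, w j b e • (((F.P K).L : ℝ)⁻¹ • logVec (su2Quat (X e)))) := ⟨_, rfl⟩
  have hlift' : ∀ j X b, lift j X b = expPoint (∑ e, w j b e • (((F.P K).L : ℝ)⁻¹ • logVec (su2Quat (X e)))) :=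
    fun j X b => by rw [hlift]
  have h := dockB_inner F hlt hLF hε₀ U hUf lift
    (fun j hj X => by
      have hj' : j + 1 ≤ (F.P K).m + (F.P K).K := by show j + 1 ≤ F.m + K; omega
      exact sum_sq_arc_lift_le_three hPd hj' (w j) (hw' j) X (lift j X) (hlift' j X))
    C E hC0 ?_
  · rw [hFL'] at h ⊢
    exact h
  -- (H) for every stage tower, from the feeders
  intro g h0 h1 h2 h3 h4 h5
  have hm : K - J ≤ (F.P K).m + (F.P K).K := by show K - J ≤ F.m + K; omega
  -- the sup budget (feeder S): profile `s`, every level `≤ 1∕8`, `Σ ≤ 1∕8`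
  obtain ⟨s, hs0, hsb, hs8, hS⟩ := hsup F γ hFL hγ hγS' J K hlt.le U hUf hUg g w
    (fun t => lift t (GaugeField.gaugeAct (g (t + 1)) (Averaging.iter (fun k => blockAvg (P := F.P K) (j := k) ℰp) (t + 1) U)))
    (fun t _ b e => hw' t b e) (fun t _ b => hlift' t _ b) h1 h4 (fun t ht => h5 t ht)
  -- the feeders
  refine Exists.elim (relLetter_of_feeders F hLF U lift g (Cs := Cs) (CL := CL) (Kc := Kc) (C_F := C_F) (C_S := C_S)
    (C_c := C₄) (Sbud := 1 / 8) hCs0 hCL0 hC_F0 hC_S0 hC₄ s hs0 hS ?_ ?_ ?_ ?_) (fun e' he' => ?_)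
  · -- F2: px13's ℓ² relative letter (its constants are `Cs`, `CL` at `d = 3`, `L`)
    intro t ht
    have ht' : t + 1 ≤ (F.P K).m + (F.P K).K := by show t + 1 ≤ F.m + K; omega
    have h2 := sq_sum_le_plaq ht' _ _ (h4 t ht)
    have eCs : ((2 * (((F.P K).d - 1) * (((F.P K).L - 1) / 2) : ℕ) * (2 * (F.P K).L ^ (F.P K).d * (((F.P K).d - 1) * (((F.P K).L - 1) / 2)) : ℕ) +
        4 * (((F.P K).d - 1) * (((F.P K).L - 1) / 2) * ((F.P K).L + 1) : ℕ) *
          (2 * (F.P K).L ^ (F.P K).d * (((F.P K).d - 1) * (((F.P K).L - 1) / 2) * ((F.P K).L + 1)) : ℕ) : ℝ)) = Cs := by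
      rw [hCs, hPL]; rfl
    have eCL : (2 : ℝ) * ((F.P K).L : ℝ) ^ ((F.P K).d - 1) = CL := by rw [hCL, hPL]; rfl
    rw [eCs, eCL] at h2
    exact h2
  · -- F1: the KEY LEMMA
    intro t ht
    rw [hKc']
    exact hkey γ hγ hγK' F hFL J K hlt.le U hUg t ht
  · -- F3: px12's flap letter in ℓ², square-rooted
    intro t ht
    have ht' : t + 1 ≤ (F.P K).m + (F.P K).K := by show t + 1 ≤ F.m + K; omega
    have h3 := sum_plaq_dist1_lift_sq_le ht' (w t) (hw' t)
      (GaugeField.gaugeAct (g (t + 1)) (Averaging.iter (fun k => blockAvg (P := F.P K) (j := k) ℰp) (t + 1) U))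
      (lift t (GaugeField.gaugeAct (g (t + 1)) (Averaging.iter (fun k => blockAvg (P := F.P K) (j := k) ℰp) (t + 1) U)))
      (hlift' t _) (fun e => hsb (t + 1) (by omega) e) ((hs8 (t + 1) (by omega)).trans (by norm_num))
    have ecF : ((((F.P K).L : ℝ)⁻¹) ^ 2) ^ 2 * ((F.P K).L : ℝ) ^ (F.P K).d = cF := by rw [hcF, hPL]; rfl
    have ed : (((F.P K).d : ℕ) : ℝ) = 3 := by rw [hPd]; norm_num
    rw [ecF, ed] at h3
    set A := ∑ p, dist1 (GaugeField.plaqHol (GaugeField.gaugeAct (g (t + 1))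
      (Averaging.iter (fun k => blockAvg (P := F.P K) (j := k) ℰp) (t + 1) U)) p) ^ 2 with hA
    set B := ∑ e, ‖logVec (su2Quat (GaugeField.gaugeAct (g (t + 1))
      (Averaging.iter (fun k => blockAvg (P := F.P K) (j := k) ℰp) (t + 1) U) e))‖ ^ 2 with hB
    have hA0 : 0 ≤ A := sum_nonneg fun _ _ => sq_nonneg _
    have hB0 : 0 ≤ B := sum_nonneg fun _ _ => sq_nonneg _
    have hst : 0 ≤ s (t + 1) := hs0 _
    calc √(∑ p, dist1 (GaugeField.plaqHol (lift t (GaugeField.gaugeAct (g (t + 1))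
          (Averaging.iter (fun k => blockAvg (P := F.P K) (j := k) ℰp) (t + 1) U))) p) ^ 2)
        ≤ √(cF * (π ^ 2 * A + 6912 * ((3 : ℝ) - 1) * s (t + 1) ^ 2 * B)) := Real.sqrt_le_sqrt h3
      _ = √(cF * π ^ 2 * A + cF * (6912 * ((3 : ℝ) - 1)) * s (t + 1) ^ 2 * B) := by ring_nf
      _ ≤ √(cF * π ^ 2 * A) + √(cF * (6912 * ((3 : ℝ) - 1)) * s (t + 1) ^ 2 * B) := sqrt_add_le_sqrt_add_sqrt_real _ _
      _ = C_F * √A + C_S * s (t + 1) * √B := by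
          rw [hC_F, hC_S, show cF * π ^ 2 * A = (√cF * π) ^ 2 * A by rw [mul_pow, Real.sq_sqrt hcF0],
            show cF * (6912 * ((3 : ℝ) - 1)) * s (t + 1) ^ 2 * B = (√cF * √(6912 * ((3 : ℝ) - 1)) * s (t + 1)) ^ 2 * B by
              rw [mul_pow, mul_pow, Real.sq_sqrt hcF0, Real.sq_sqrt (by norm_num)],
            Real.sqrt_mul (sq_nonneg _), Real.sqrt_mul (sq_nonneg _), Real.sqrt_sq (by positivity), Real.sqrt_sq (by positivity)]
  · -- F4: px21 g21's corr letter in ℓ², spine form, through (T5) + (W1)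
    intro t ht
    have ht' : t + 1 ≤ (F.P K).m + (F.P K).K := by show t + 1 ≤ F.m + K; omega
    have hsmall : PlaqSmall a₀ (GaugeField.gaugeAct (g t) (Averaging.iter (fun k => blockAvg (P := F.P K) (j := k) ℰp) t U)) := by
      intro p
      rw [T4ReTrLipUnitary.plaqHol_gaugeAct, GaugeGroup.dist1_conj]
      exact lt_of_lt_of_le (hUg t (by omega) p) (hθa _)
    have havg : ∀ c : PBond (F.P K) (t + 1),
        AveragingRT.axialAvg (lift t (GaugeField.gaugeAct (g (t + 1)) (Averaging.iter (fun k => blockAvg (P := F.P K) (j := k) ℰp) (t + 1) U))) c =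
        avgFun ℰp (GaugeField.gaugeAct (g t) (Averaging.iter (fun k => blockAvg (P := F.P K) (j := k) ℰp) t U)) c := by
      intro c
      rw [axialAvg_lift ht' (w t) (hw' t) _ _ (hlift' t _)]
      exact (congrFun (h5 t ht) c).symm
    have hδ4 : ((((((F.P K).d + 2) * (F.P K).L : ℕ) : ℝ) ^ 2 / 4)) * a₀ ≤ 1 / 4 := by rw [hPd, hPL, ← hG]; exact hGa4
    have hδN : ((((((F.P K).d + 2) * (F.P K).L : ℕ) : ℝ) ^ 2 / 4)) * a₀ < ExpMeanLog.deltaSU (Fin 2) := by rw [hPd, hPL, ← hG]; exact hGaN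
    have h4c := sqrt_sum_dist1_spine_sq_le ht' _ _ havg ha₀0.le hsmall hδ4 hδN
    have eC4 : 3 * ((((((F.P K).d + 2) * (F.P K).L : ℕ) : ℝ) ^ 2 / 4)) *
        √(((3 ^ (F.P K).d * (F.P K).L ^ (F.P K).d * (F.P K).d ^ 2 : ℕ) : ℝ) * ((3 ^ (F.P K).d * (F.P K).d : ℕ) : ℝ)) = C₄ := by
      rw [hC4, hG, hPL]; rfl
    rw [eC4] at h4c
    exact h4c
  · -- (H) with my own witness `e` (the explicit profile) — `he'.2.2` is the displayed clause
    obtain ⟨-, -, hH⟩ := he'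
    have hLs : 0 < Real.sqrt (F.L : ℝ) := Real.sqrt_pos.mpr (by linarith)
    refine ⟨fun j => π / 2 * √(2 * Cs) * C_S * s (j + 1) / Real.sqrt (F.L : ℝ),
      fun j => div_nonneg (mul_nonneg (mul_nonneg (mul_nonneg (by positivity) (Real.sqrt_nonneg _)) hC_S0) (hs0 _))
        (Real.sqrt_nonneg _), ?_, fun j hj => (hH j hj).trans ?_⟩
    · -- the budget `Σ e ≤ E`
      have hb0 : 0 ≤ π / 2 * √(2 * Cs) * C_S := by positivity
      have hsum : ∑ j ∈ range (K - J), π / 2 * √(2 * Cs) * C_S * s (j + 1) / Real.sqrt (F.L : ℝ) =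
          π / 2 * √(2 * Cs) * C_S * (∑ j ∈ range (K - J), s (j + 1)) / Real.sqrt (F.L : ℝ) := by
        rw [Finset.mul_sum, Finset.sum_div]
      rw [hsum, hE, hFL']
      exact div_le_div_of_nonneg_right (mul_le_mul_of_nonneg_left hS hb0) (Real.sqrt_nonneg _)
    · have hCle : π / 2 * (Kc * (√(2 * Cs) * (1 + C_F * Real.sqrt (F.L : ℝ)) + √CL * C₄)) ≤ C := by rw [hC, hFL']; linarith
      have hmono : π / 2 * (Kc * (√(2 * Cs) * (1 + C_F * Real.sqrt (F.L : ℝ)) + √CL * C₄)) * Real.sqrt (F.L : ℝ) ^ j *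
          √(∑ p, dist1 (GaugeField.plaqHol U p) ^ 2) ≤
          C * Real.sqrt (F.L : ℝ) ^ j * √(∑ p, dist1 (GaugeField.plaqHol U p) ^ 2) :=
        mul_le_mul_of_nonneg_right (mul_le_mul_of_nonneg_right hCle (by positivity)) (Real.sqrt_nonneg _)
      exact add_le_add le_rfl hmono

end Summit.QuantumFields.YangMills.Theorems.FluctuationComparisonRegPrIntLS2BetaHFlatOfKeyLemma

end
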